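import Mathlib
import HarnessLib.Audit.Tags
import Summits.Ventures.ResidMod.Conjectures.SquareClassImprimitivity

/-!
# Venture ResidMod — DERIVATION-19 Lemma 1, GALOIS HALF: `M19_galois_card_dvd` PROVED
# (census cell `pub-residmod`, STRUCTURE.md TODO-27, rung 19 / mechanism `M-19`)

HONEST FRAMING. This file PROVES the statement `M19_galois_card_dvd` typed (and left owed) in
`SquareClassImprimitivity.lean`: for a non-degenerate integer sextic `f` in the SQUARE CLASS of the twisted-3-torsion
family (`4f = G² + c·ℓ⁶`, `deg G ≤ 3`, `deg ℓ ≤ 1`, `c ≠ 0`), the Galois group of `f` over `ℚ` has order dividing `72`.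
Hence (`M19_not_typical`, PROVED) such an `f` is never `Typical` (`|Gal f| ≥ 360`) and its Galois group has no element
of order `5` — the theorem-grade explanation of STRUCTURE.md NULL-13 («typical ∧ square-class = 0 / 424 495 members at
naive height 24», SCORES-19 `ddf4a842…`) promised by DERIVATION-19 Lemma 1 (`bba47bd8…`, registered R278; this file's
statement list registered R282 before any proof was written). Elementary field theory only; no curve, no Galois image of
an abelian surface, no conductor, no modularity statement is touched.

PROOF (as formalised). Let `K` be the splitting field of `X² + c` over `ℚ` (`[K:ℚ] = |Gal(X²+c)|` divides `2! = 2`) and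
`s ∈ K` with `s² = −c`. Over `K`, `4f = A·B` with `A = G − sℓ³`, `B = G + sℓ³` of degree `≤ 3`
(`sq_norm_factorisation`). With `f_K = f ⊗ K`: `Gal(f_K/K)` is a quotient of `Gal(A·B/K)` (`f_K ∣ A·B`,
`Polynomial.Gal.restrictDvd_surjective`), which embeds in `Gal(A/K) × Gal(B/K)` (`restrictProd_injective`), whose order
divides `3!·3! = 36` (`Gal(g) ↪ Sym(roots of g)`). Let `E` be the splitting field of `f_K` over `K`:
`[E:K] = |Gal(f_K/K)|` (separability is inherited from `f`), so `[E:ℚ] = [K:ℚ]·[E:K]` divides `72`; and `f` splits in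
`E`, so the splitting field `L` of `f` over `ℚ` embeds in `E` and `[L:ℚ] ∣ [E:ℚ]` (tower law through the embedding).
Finally `|Gal(f/ℚ)| = [L:ℚ]`.

CONTENTS. `card_gal_dvd_factorial`, `card_gal_mul_dvd` (folklore, any field; the `ℚ` versions exist in
`Summits/Langlands/…/MuOrdinaryFamilyRT/Negative/GenericClass.lean`) · `finrank_splittingField_dvd` (tower through an
embedding) · `sqRep_factor_over` (the factorisation over a field containing `√−c`, with degree bounds) ·
`M19_galois_card_dvd_holds : M19_galois_card_dvd` · `M19_not_typical` · `M19_orderOf_ne_five` ·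
`sqRep_linear_not_dvd` (the extractor lemma: `ℓ ∤ G` for linear `ℓ`, referee g35 obs (i)).
-/

open Polynomial Module

namespace Summit.Ventures.ResidMod.Conjectures

/-- The Galois group of a polynomial over a field embeds in the permutations of its (at most `natDegree`) roots, so its
order divides `natDegree !`. [folklore] -/
theorem card_gal_dvd_factorial {K : Type*} [Field K] (g : K[X]) :
    Nat.card g.Gal ∣ (g.natDegree).factorial := by
  classical
  let L := g.SplittingField
  have hS : (g.map (algebraMap K L)).Splits := SplittingField.splits g
  haveI : Fact ((g.map (algebraMap K L)).Splits) := ⟨hS⟩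
  have hdvd : Nat.card g.Gal ∣ (Nat.card (g.rootSet L)).factorial := by
    rw [← Nat.card_perm]
    exact Subgroup.card_dvd_of_injective _ (Gal.galActionHom_injective g L)
  refine dvd_trans hdvd (Nat.factorial_dvd_factorial ?_)
  have hrs : Nat.card (g.rootSet L) = (g.map (algebraMap K L)).roots.toFinset.card := by
    rw [rootSet_def, Finset.coe_sort_coe, Nat.card_eq_finsetCard]
  rw [hrs]
  calc (g.map (algebraMap K L)).roots.toFinset.card ≤ (g.map (algebraMap K L)).roots.card :=
        Multiset.toFinset_card_le _
    _ ≤ (g.map (algebraMap K L)).natDegree := card_roots' _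
    _ = g.natDegree := natDegree_map _

/-- The Galois group of a product embeds in the product of the Galois groups. [folklore] -/
theorem card_gal_mul_dvd {K : Type*} [Field K] (a b : K[X]) :
    Nat.card (a * b).Gal ∣ Nat.card a.Gal * Nat.card b.Gal := by
  rw [← Nat.card_prod]
  exact Subgroup.card_dvd_of_injective _ (Gal.restrictProd_injective a b)

/-- Tower law through an embedding: if `F ∈ k[X]` splits in a field extension `E` of `k`, the splitting field of `F`
embeds in `E` over `k`, so its degree divides `[E : k]` (as natural numbers; `finrank = 0` for infinite `E` is harmless).
[folklore] -/
theorem finrank_splittingField_dvd {k E : Type*} [Field k] [Field E] [Algebra k E] (F : k[X])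
    (h : (F.map (algebraMap k E)).Splits) : finrank k F.SplittingField ∣ finrank k E := by
  let φ : F.SplittingField →ₐ[k] E := SplittingField.lift F h
  letI : Algebra F.SplittingField E := φ.toRingHom.toAlgebra
  haveI : IsScalarTower k F.SplittingField E :=
    IsScalarTower.of_algebraMap_eq (fun x => (φ.commutes x).symm)
  exact Dvd.intro _ (Module.finrank_mul_finrank k F.SplittingField E)

/-- The square-class identity transported to a field `K` of characteristic `0` containing `s` with `s² = −c`:
`4·f_K = A·B` with `A = G − sℓ³`, `B = G + sℓ³` both of degree `≤ 3`, and `f_K` of degree `6`. -/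
theorem sqRep_factor_over {K : Type*} [Field K] [CharZero K] {f : Sextic} (hf : f 6 ≠ 0)
    {c : ℤ} {G ℓ : ℤ[X]} (hG : G.natDegree ≤ 3) (hℓ : ℓ.natDegree ≤ 1)
    (hrep : C 4 * toPoly f = G ^ 2 + C c * ℓ ^ 6) {s : K} (hs : s ^ 2 = -(c : K)) :
    ∃ A B : K[X], C (4 : K) * (toPoly f).map (Int.castRingHom K) = A * B ∧
      A.natDegree ≤ 3 ∧ B.natDegree ≤ 3 ∧ ((toPoly f).map (Int.castRingHom K)).natDegree = 6 := by
  set φ : ℤ →+* K := Int.castRingHom K with hφ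
  refine ⟨G.map φ - C s * (ℓ.map φ) ^ 3, G.map φ + C s * (ℓ.map φ) ^ 3, ?_, ?_, ?_, ?_⟩
  · have h := congrArg (Polynomial.map φ) hrep
    simp only [Polynomial.map_mul, Polynomial.map_add, Polynomial.map_pow, Polynomial.map_C] at h
    rw [map_ofNat φ 4, eq_intCast φ c] at h
    rw [h]
    exact sq_norm_factorisation _ _ _ _ hs
  · have hGm : (G.map φ).natDegree ≤ 3 := natDegree_map_le.trans hG
    have hLm : (ℓ.map φ).natDegree ≤ 1 := natDegree_map_le.trans hℓ
    have hT : (C s * (ℓ.map φ) ^ 3).natDegree ≤ 3 :=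
      (natDegree_C_mul_le _ _).trans (natDegree_pow_le.trans (by omega))
    exact (natDegree_sub_le _ _).trans (max_le hGm hT)
  · have hGm : (G.map φ).natDegree ≤ 3 := natDegree_map_le.trans hG
    have hLm : (ℓ.map φ).natDegree ≤ 1 := natDegree_map_le.trans hℓ
    have hT : (C s * (ℓ.map φ) ^ 3).natDegree ≤ 3 :=
      (natDegree_C_mul_le _ _).trans (natDegree_pow_le.trans (by omega))
    exact (natDegree_add_le _ _).trans (max_le hGm hT)
  · rw [natDegree_map_eq_of_injective φ.injective_int, natDegree_toPoly hf]

/-- **DERIVATION-19 Lemma 1, Galois half — PROVED.** For a non-degenerate square-class sextic `f`,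
`|Gal(f/ℚ)| ∣ 72`. (Closes the owed statement `M19_galois_card_dvd` of `SquareClassImprimitivity.lean` BY NAME.) -/
theorem M19_galois_card_dvd_holds : M19_galois_card_dvd := by
  classical
  unfold M19_galois_card_dvd
  intro f hnd hsq
  obtain ⟨c, G, ℓ, hc, hℓ0, hG, hℓ1, hrep⟩ := hsq
  have hf6 : f 6 ≠ 0 := hnd.1
  have hFsep : (toRatPoly f).Separable := hnd.2
  -- (1) the field `K = ℚ(√−c)` as the splitting field of `X² + c`; `[K:ℚ] ∣ 2`
  set q : ℚ[X] := X ^ 2 - C (-(c : ℚ)) with hq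
  have hc' : (-(c : ℚ)) ≠ 0 := neg_ne_zero.mpr (by exact_mod_cast hc)
  have hqdeg : q.natDegree = 2 := by rw [hq, natDegree_X_pow_sub_C]
  have hqsep : q.Separable := separable_X_pow_sub_C _ (by norm_num) hc'
  let K := q.SplittingField
  have hK2 : finrank ℚ K ∣ 2 := by
    have h := card_gal_dvd_factorial q
    rw [Gal.card_of_separable hqsep, hqdeg] at h
    exact h
  obtain ⟨s, hs⟩ : ∃ s : K, s ^ 2 = -(c : K) := by
    have hsp : (q.map (algebraMap ℚ K)).Splits := SplittingField.splits q
    have hdeg : (q.map (algebraMap ℚ K)).degree ≠ 0 :=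
      (natDegree_pos_iff_degree_pos.mp (by rw [natDegree_map, hqdeg]; norm_num)).ne'
    obtain ⟨s, hs⟩ := hsp.exists_eval_eq_zero hdeg
    refine ⟨s, ?_⟩
    rw [eval_map_algebraMap] at hs
    have hs' : aeval s (X ^ 2 - C (-(c : ℚ)) : ℚ[X]) = 0 := hs
    rw [map_sub, map_pow, aeval_X, aeval_C, map_neg, map_intCast] at hs'
    linear_combination hs'
  -- (2) the factorisation `4 f_K = A·B` over `K`
  set FK : K[X] := (toRatPoly f).map (algebraMap ℚ K) with hFK
  have hFK' : FK = (toPoly f).map (Int.castRingHom K) := by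
    rw [hFK, toRatPoly, Polynomial.map_map]
    congr 1
  obtain ⟨A, B, hAB, hA3, hB3, hdeg6⟩ := sqRep_factor_over hf6 hG hℓ1 hrep hs
  rw [← hFK'] at hAB hdeg6
  have hP0 : A * B ≠ 0 := by
    rw [← hAB]
    refine mul_ne_zero (by rw [Ne, C_eq_zero]; norm_num) ?_
    intro h0
    rw [h0, natDegree_zero] at hdeg6
    omega
  have hdvdP : FK ∣ A * B := by
    rw [← hAB]
    exact dvd_mul_left FK (C 4)
  -- (3) `|Gal(f_K/K)| ∣ 36`
  have hGalFK : Nat.card FK.Gal ∣ 36 := by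
    have h1 : Nat.card FK.Gal ∣ Nat.card (A * B).Gal :=
      Subgroup.card_dvd_of_surjective _ (Gal.restrictDvd_surjective hdvdP hP0)
    have hA : Nat.card A.Gal ∣ 6 :=
      (card_gal_dvd_factorial A).trans ((Nat.factorial_dvd_factorial hA3).trans (by decide))
    have hB : Nat.card B.Gal ∣ 6 :=
      (card_gal_dvd_factorial B).trans ((Nat.factorial_dvd_factorial hB3).trans (by decide))
    calc Nat.card FK.Gal ∣ Nat.card (A * B).Gal := h1
      _ ∣ Nat.card A.Gal * Nat.card B.Gal := card_gal_mul_dvd A B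
      _ ∣ 6 * 6 := mul_dvd_mul hA hB
  -- (4) the tower `ℚ ⊆ K ⊆ E`, `E` the splitting field of `f_K` over `K`, and `L ↪ E`
  let E := FK.SplittingField
  have hFKsep : FK.Separable := hFsep.map
  have hE : finrank K E = Nat.card FK.Gal := (Gal.card_of_separable hFKsep).symm
  have hsplitE : ((toRatPoly f).map (algebraMap ℚ E)).Splits := by
    rw [IsScalarTower.algebraMap_eq ℚ K E, ← Polynomial.map_map]
    exact SplittingField.splits FK
  have hL : finrank ℚ (toRatPoly f).SplittingField ∣ finrank ℚ E := finrank_splittingField_dvd _ hsplitE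
  have htower : finrank ℚ K * finrank K E = finrank ℚ E := Module.finrank_mul_finrank ℚ K E
  rw [Gal.card_of_separable hFsep]
  calc finrank ℚ (toRatPoly f).SplittingField ∣ finrank ℚ E := hL
    _ = finrank ℚ K * finrank K E := htower.symm
    _ ∣ 2 * 36 := mul_dvd_mul hK2 (hE ▸ hGalFK)

/-- PROVED (unconditional form of `M19_not_typical_of_card_dvd`): a non-degenerate square-class sextic is never
`Typical`. This is STRUCTURE.md NULL-13 as a theorem about the typed notions. -/
theorem M19_not_typical : ∀ f : Sextic, NonDegenerate f → MemberSQ f → ¬ Typical f :=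
  M19_not_typical_of_card_dvd M19_galois_card_dvd_holds

/-- PROVED: the Galois group of a non-degenerate square-class sextic has no element of order `5` (so, by Dedekind's
theorem — quoted, not formalised —, no unramified prime shows the `(5,1)` cycle pattern the rung-18 certificate needs). -/
theorem M19_orderOf_ne_five {f : Sextic} (hnd : NonDegenerate f) (hsq : MemberSQ f)
    (g : (toRatPoly f).Gal) : orderOf g ≠ 5 :=
  orderOf_ne_five_of_card_dvd_72 (M19_galois_card_dvd_holds f hnd hsq) g

/-- **Extractor lemma** (referee g35 observation (i), cell bus 2026-08-23T14:29Z, accepted by lead g12): in a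
square-class representation `4·f = G² + c·ℓ⁶` with `ℓ` LINEAR and `f` separable over `ℚ`, the line `ℓ` does not
divide `G` — otherwise `ℓ² ∣ 4·f` and `f` has a repeated root. In the `ℓ`-frame (`x = (ℓ − a)/m`) this says the
constant term of `4·f` equals `G(−a/m)² > 0`, which is exactly what makes the square-class extractors' shortcut
«`ℓ`-frame constant term `≤ 0` ⇒ no representation in the class of `ℓ`» (`structure/rung19/sq19.py`,
`referee/g35/sq19own_g35.py`) a theorem rather than a heuristic. PROVED; 0 core-h. -/
theorem sqRep_linear_not_dvd {f : Sextic} (hsep : (toRatPoly f).Separable) {c : ℤ} {G ℓ : ℤ[X]}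
    (hℓ : ℓ.natDegree = 1) (hrep : C 4 * toPoly f = G ^ 2 + C c * ℓ ^ 6) : ¬ ℓ ∣ G := by
  rintro ⟨q, rfl⟩
  -- `ℓ² ∣ 4·f` over `ℤ`, hence over `ℚ`, hence `ℓ² ∣ f` over `ℚ`
  have hdvdZ : ℓ ^ 2 ∣ C 4 * toPoly f := ⟨q ^ 2 + C c * ℓ ^ 4, by rw [hrep]; ring⟩
  have hdvdQ : (ℓ.map (Int.castRingHom ℚ)) ^ 2 ∣ C (4 : ℚ) * toRatPoly f := by
    have h := Polynomial.map_dvd (Int.castRingHom ℚ) hdvdZ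
    rw [Polynomial.map_pow, Polynomial.map_mul, Polynomial.map_C, map_ofNat] at h
    exact h
  have hunit : IsUnit (C (4 : ℚ)) := Polynomial.isUnit_C.mpr (isUnit_iff_ne_zero.mpr (by norm_num))
  have hdvdQ' : ℓ.map (Int.castRingHom ℚ) * ℓ.map (Int.castRingHom ℚ) ∣ toRatPoly f := by
    rw [← pow_two]; exact hunit.dvd_mul_left.mp hdvdQ
  -- separable ⇒ squarefree ⇒ `ℓ` is a unit over `ℚ`, contradicting `deg ℓ = 1`
  have hu : IsUnit (ℓ.map (Int.castRingHom ℚ)) := hsep.squarefree _ hdvdQ'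
  have hdeg : (ℓ.map (Int.castRingHom ℚ)).natDegree = 1 := by
    rw [Polynomial.natDegree_map_eq_of_injective (Int.castRingHom ℚ).injective_int, hℓ]
  have h0 := Polynomial.natDegree_eq_zero_of_isUnit hu
  omega

end Summit.Ventures.ResidMod.Conjectures
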